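import Literature.MathematicalPhysics.QuantumFieldTheory.Balaban1983to89.B11Prop6Concrete

/-!
# `Balaban1983to89.B11Prop6ConcreteWitness` — [Balaban1985Variational] Proposition 6 (pp. 295–296) on the concrete (115) carriers:
# NON-VACUITY of the hypotheses of `B11Prop6Concrete.prop6Printed_concrete` (the flat stratum U₀ ≡ 1 lies in every class (2);
# the datum `SectEDatum` / `Rest` is inhabited with (14) and admissibility SATISFIABLE, so the typed Proposition 6 is not an ex-falso)

statement-level skeleton of published theorems with citation tags; proofs where landed; nothing here is a claim
about the Yang–Mills mass gap

WHY THIS FILE.  `B11Prop6Concrete.prop6Printed_concrete : B11.Prop6Printed B₀ B₃ C₁ (fun i ↦ (D i).toLGData (R i) C₁)` holds for EVERY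
family of Sect. E data at objects; a referee's vacuity audit (pub-ymgap R417 act (iv), A1–A6) asks whether the binders of the typed statement —
the pin's (14) `Sat14 (C₁B₃ε₁) (C₁ε₁) V U₀` together with `2B₀C₁B₃ε₁ ≤ ε₄ ≤ a₄` and an admissible background — can hold AT ALL for some datum.
THIS FILE answers it at the FLAT STRATUM (p. 279 (11)/(14) at the trivial datum; [Balaban1985Variational] (2) p. 278 contains U ≡ 1 at every
radius): §1 the flat background `U₀ ≡ 1` is unitary and lies in the current class (2) of every radius `a ≥ 0` (its plaquette variables are 1 and
`D*∂U₀ = 0`, computed from r08's `B9Eq39Adjoint.divP`/`plaqU`); §2 an explicit Sect. E datum (letters 𝔊 = 0, W = 0, H₁ = 0, B = 0 — the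
degenerate but ADMISSIBLE values of the slots; norms ≤ B₀, Prop. 4 with any C₄ ≥ 0) and `Rest` with `Sat14 a b V U₀ := 0 ≤ a ∧ 0 < b`
meeting its three printed readings, whence **`prop6_binders_satisfiable`**: for every ε₁ > 0 the antecedents of `B11.Prop6Printed` hold at this
datum (so the ∀-clauses of `prop6Printed_concrete` are exercised, with the solution A₁ = 0); §3 **`norm_solA_zero_le_two_osc`** — R1^ϱ for
the tree's solution OPERATOR at exact constraints, `‖solA 𝔊 0 W J(U₀) ε₄ 0‖₍₁₁₅₎ ≤ 2‖𝔊J(U₀)‖₍₁₁₅₎`, i.e. the binder shape `hresp : nrm ≤ 2·osc` of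
`T4FixedPointResponse.localRate_of_oneStep` at the objects of one background (the identification of NE3's `nrm` with this solution is Props 2/5/7
at objects, not claimed).  Genuine-letter witnesses per lattice (𝔊(U₀) =
`frakGLatticeCLM`, H₁(U₀) = `H1LatticeCLM`, W = `W80` with background-dependent radii) are the NE9 lineage's `NE9CurChartOneInstance*` (Summits
side) and are not repeated here.

HONEST SCOPE.  Kernel bookkeeping (0 def, 0 sorry); no estimate of the series; count-neutral (pub-ymgap Track A, node N07, seat dag-n07-b g2;
`--supports stmt-QuantumFields-19183`).  Imports `B11Prop6Concrete` ONLY.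
-/

noncomputable section

open Metric Set

namespace Literature.MathematicalPhysics.QuantumFieldTheory.Balaban1983to89.B11Prop6ConcreteWitness

open B11Prop6Scheme (Prop4Hyp)
open B11Prop6Concrete
open B11Eq90V0primeCurrent (Tsh Ucur)
open B11Eq111FrakG (nabla115)
open B9SectCLatticeCarrier (Bond)
open B11Eq115Space

variable {𝔸 : Type} [NormedRing 𝔸] [NormedAlgebra ℂ 𝔸] [StarRing 𝔸]
variable {d : ℕ} {Pd : Fin d → ℕ} {L η : ℝ} [Fact (0 < L)] [Fact (0 < η)] {lev₀ : Bond d Pd → ℕ}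

/-! ## §1 The flat background lies in every class (2) -/

omit [NormedAlgebra ℂ 𝔸] in
/-- The flat background `U₀ ≡ 1` is G-valued: `1⁻¹ = 1 = 1*`. [cite: Balaban1985Variational, (2) p.278] -/
theorem isUnitaryBg_one : IsUnitaryBg (1 : Bond d Pd → 𝔸ˣ) := fun b => by
  simp

omit [StarRing 𝔸] in
/-- **The flat background lies in the current class (2) of every radius `a ≥ 0`**: its plaquette variables are `1` and the covariant divergence
of the constant plaquette field vanishes, `(D*_{U₀}∂U₀)(b) = 0` (computed from r08's `B9Eq39Adjoint.covDstar`/`divP`/`plaqU`).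
[cite: Balaban1985Variational, (2) p.278, (14) p.280] -/
theorem inU2cur_one {a : ℝ} (ha : 0 ≤ a) : InU2cur L η lev₀ a (1 : Bond d Pd → 𝔸ˣ) := by
  intro b
  have h0 : B9Eq39Adjoint.divPη Tsh (Ucur (1 : Bond d Pd → 𝔸ˣ)) η
      (B11Eq27Current.plaqField Tsh (Ucur (1 : Bond d Pd → 𝔸ˣ))) b.2 b.1 = 0 := by
    simp [B9Eq39Adjoint.divPη, B9Eq39Adjoint.divP, B9Eq39Adjoint.covDstar, B9Eq39Adjoint.R, B11Eq27Current.plaqField,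
      B9Eq39Adjoint.plaqU, Ucur]
  rw [h0, norm_zero]
  have hη : (0 : ℝ) < η := Fact.out
  have hw : 0 < levWeight L η lev₀ 1 b := levWeight_pos (Fact.out : 0 < L) hη lev₀ 1 b
  positivity

/-! ## §2 A Sect. E datum with (14) and admissibility satisfiable; the binders of Proposition 6 hold -/

variable (d Pd 𝔸 L η) in
/-- **The binders of `B11.Prop6Printed` are jointly satisfiable on the family of `B11Prop6Concrete`** (flat stratum; degenerate admissible letters
𝔊 = 0, W = 0, H₁ = 0, B = 0; `Sat14 a b V U₀ := 0 ≤ a ∧ 0 < b`, whose readings `sat14_cur`/`sat14_B`/`sat14_adm` hold by §1 and ‖0‖ < 2dL·b):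
for `0 ≤ B₀`, `0 ≤ C₄`, `0 < dL ≤ B₃` there are a datum `D`, remaining fields `R`, a boundary datum `V` and an ADMISSIBLE background `c` such that
the carrier's (14) holds at the printed parameters `(C₁B₃ε₁, C₁ε₁)` for EVERY `C₁, ε₁ > 0` (and `B₃ > 0`) — so for ε₁ with `2B₀C₁B₃ε₁ ≤ ε₄ ≤ a₄` all
antecedents of `prop6Printed_concrete`'s clauses are met. [cite: Balaban1985Variational, Prop. 6 p.295, (14) p.280] -/
theorem prop6_binders_satisfiable (β : Type) [Fintype β] {B₀ C₄ a₃ B₃ α : ℝ} (hB₀ : 0 ≤ B₀) (hC₄ : 0 ≤ C₄)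
    (hdL : 0 < (d : ℝ) * L) (hdLB₃ : (d : ℝ) * L ≤ B₃) (lev₀ : Bond d Pd → ℕ) (lev₁ : Bond d Pd × Fin d → ℕ) :
    ∃ (D : SectEDatum d Pd 𝔸 L η β B₀ C₄ a₃ B₃ α) (R : Rest D) (V : D.Bdry) (c : D.Cfg),
      D.Adm c ∧ D.bg c = 1 ∧
        ∀ C₁ ε₁ : ℝ, 0 < C₁ → 0 < ε₁ → 0 < B₃ → (D.toLGData R C₁).Sat14 (C₁ * B₃ * ε₁) (C₁ * ε₁) V c := by
  classical
  let D : SectEDatum d Pd 𝔸 L η β B₀ C₄ a₃ B₃ α :=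
    { Cfg := PUnit
      Adm := fun _ => True
      Bdry := PUnit
      lev₀ := lev₀
      lev₁ := lev₁
      bg := fun _ => 1
      bg_unitary := fun _ => isUnitaryBg_one
      G := fun _ => 0
      W := fun _ _ => 0
      H₁ := fun _ => 0
      Bcfg := fun _ _ _ => 0
      norm_G := fun _ _ f => by simpa using mul_nonneg hB₀ (norm_nonneg f)
      prop4 := fun _ _ => ⟨fun Y _ => by simpa using mul_nonneg hC₄ (sq_nonneg ‖Y‖), differentiableOn_const _⟩
      norm_H₁ := fun _ _ b => by simpa using mul_nonneg hB₀ (norm_nonneg b)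
      dL_le := hdLB₃ }
  let R : Rest D :=
    { Pert := PUnit
      GT := PUnit
      Cell := PUnit
      Site := PUnit
      scale := fun _ => 0
      cscale := fun _ => 0
      dist := fun _ _ => 0
      Sat14 := fun a b _ _ => 0 ≤ a ∧ 0 < b
      sat14_cur := fun a b _ _ h => inU2cur_one h.1
      sat14_B := fun a b _ _ h => by
        have h0 : ((fun _ : β => (0 : 𝔸)) : β → 𝔸) = 0 := rfl
        show ‖(fun _ : β => (0 : 𝔸))‖ < 2 * ((d : ℝ) * L) * b
        rw [h0, norm_zero]
        exact mul_pos (mul_pos two_pos hdL) h.2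
      sat14_adm := fun _ _ _ _ _ _ => trivial
      In18 := fun _ _ _ _ => True
      Crit := fun _ _ _ => True
      In19_21 := fun _ _ _ _ => True
      CritL := fun _ _ _ => True
      Restricted := fun _ _ => True
      toAxial := fun _ p _ => p
      In43 := fun _ _ _ => True
      nM1 := fun _ _ => 0
      Def47 := fun _ _ => True
      T47 := fun _ A => A
      normD := fun _ _ => 0
      kerD := fun _ _ _ _ => 0
      T112 := fun _ _ _ => PUnit.unit }
  refine ⟨D, R, PUnit.unit, PUnit.unit, trivial, rfl, fun C₁ ε₁ hC₁ hε₁ hB₃ => ?_⟩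
  show 0 ≤ C₁ * B₃ * ε₁ ∧ 0 < C₁ * ε₁
  exact ⟨by positivity, by positivity⟩

/-! ## §3 R1^ϱ in NE3's binder shape: the solution operator against the propagated concrete residual (Γ = 2) -/

section Hresp

variable [FiniteDimensional ℂ 𝔸] [NormedStarGroup 𝔸] [StarModule ℂ 𝔸] {lev₁ : Bond d Pd × Fin d → ℕ}

/-- **R1^ϱ FOR THE SOLUTION OPERATOR, exact constraints** — the shape of the binder `hresp : nrm ≤ Γ·osc` of
`T4FixedPointResponse.localRate_of_oneStep` (pub-balaban NE3 v4 re-cut, Γ = 2) AT THE OBJECTS of one background: for a unitary `U₀` in the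
current class (2) of radius `C₁B₃ε₁`, letters `𝔊` ([5] Thm 3.13 bound B₀) and `W` (Prop. 4) in Proposition 6's regime (`2B₀C₁B₃ε₁ ≤ ε₄`,
`4ε₄ ≤ a₃`, `16B₀C₄ε₄ ≤ 1`, `0 < dL ≤ B₃`), the tree's solution `𝒜 := solA 𝔊 0 W J(U₀) ε₄ 0` of (111) with `𝔄 = 0` (p. 299 *«B = 0»*)
obeys `‖𝒜‖₍₁₁₅₎ ≤ 2‖𝔊J(U₀)‖₍₁₁₅₎` with the CONCRETE current `J(U₀) = Jcur U₀` — `nrm := ‖𝒜‖`, `osc := ‖𝔊(U₀)J(U₀)‖`.  (That NE3's reading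
`nrm` — the (115)-distance of consecutive minimisers in B8's gauge — IS this ‖𝒜‖ is Props 2, 5, 7 at objects, NOT claimed here.)
[cite: Balaban1985Variational, Prop. 6 p.295, (121) p.295, p.299] -/
theorem norm_solA_zero_le_two_osc (U₀ : Bond d Pd → 𝔸ˣ)
    {𝒢 : NegSize L η lev₀ 3 𝔸 →L[ℂ] Space115 L η lev₀ lev₁ (nabla115 η U₀)}
    {W : Space115 L η lev₀ lev₁ (nabla115 η U₀) → NegSize L η lev₀ 3 𝔸} {B₀ C₄ a₃ : ℝ}
    (h𝒢 : ∀ f, ‖𝒢 f‖ ≤ B₀ * ‖f‖) (hW : B13Contraction113.QuadAnalytic W C₄ a₃) (hB₀ : 0 < B₀) (hC₄ : 0 < C₄)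
    {C₁ B₃ ε₁ ε₄ : ℝ} (hC₁ : 0 < C₁) (hB₃ : 0 < B₃) (hε₁ : 0 < ε₁) (hdL : 0 < (d : ℝ) * L) (hdLB₃ : (d : ℝ) * L ≤ B₃)
    (h1 : 2 * B₀ * C₁ * B₃ * ε₁ ≤ ε₄) (h2 : 4 * ε₄ ≤ a₃) (h3 : 16 * B₀ * C₄ * ε₄ ≤ 1)
    (hU : IsUnitaryBg U₀) (h14 : InU2cur L η lev₀ (C₁ * B₃ * ε₁) U₀) :
    ‖B11Eq174Chart.solA 𝒢 0 W (B11Eq98CurrentSlot.Jcur U₀) ε₄ 0‖ ≤ 2 * ‖𝒢 (B11Eq98CurrentSlot.Jcur U₀)‖ := by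
  have h𝔄 : ‖(0 : Space115 L η lev₀ lev₁ (nabla115 η U₀))‖ < 2 * ((d : ℝ) * L) * B₀ * C₁ * ε₁ := by
    rw [norm_zero]; positivity
  obtain ⟨hlt, hsol, -⟩ := solA_spec_concrete U₀ h𝒢 hW hB₀ hC₄ hC₁ hB₃ hε₁ hdLB₃ h1 h2 h3 hU h14 h𝔄
  have h := r1rho_concrete_printed U₀ h𝒢 hW hB₀.le hC₄.le hC₁.le hε₁.le hdLB₃ h1 h2 h3 h𝔄 hlt.le hsol
  simpa using h

end Hresp

end Literature.MathematicalPhysics.QuantumFieldTheory.Balaban1983to89.B11Prop6ConcreteWitness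

end
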